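import Literature.AlgebraicGeometry.ModuliOfAbelianVarieties.Lan2013.Sec11PreliminariesAlgebra
import Literature.AlgebraicGeometry.ModuliOfAbelianVarieties.Lan2013.Sec142to144IsogenyClasses
import HarnessLib

/-!
# Lan 2013, §1.1.1 — bridge: `IsOrder ℤ ℚ` ∕ `IsMaximalOrder ℤ ℚ` (general `R`-orders, `Sec11PreliminariesAlgebra`) versus
# `IsZOrder` ∕ `IsMaximalZOrder` (the `R = ℤ`, `Subring`-based form of `Sec142to144IsogenyClasses`)

Theorem-only companion (squad TS ruling TS-1; cell hodgecm-mathlib, seat TS-t06): the two typings of [Lan2013PELCompactifications]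
Def. 1.1.1.3 ∕ Def. 1.1.1.4 (book p. 2) in the tree agree for `R = ℤ`.  `Sec11PreliminariesAlgebra.IsOrder R K A O` is
`Submodule.IsLattice K (Subalgebra.toSubmodule O)` (finitely generated over `R` and `K`-spanning) for an `R`-subalgebra `O`;
`Sec142to144IsogenyClasses.IsZOrder B O` is «`(O : ℤ-submodule).FG ∧ ℚ · O = B`» for a subring `O`.  A subring of `B` is the
same thing as a `ℤ`-subalgebra (`subalgebraOfSubring`, inverse `Subalgebra.toSubring`), and under this identification the two
predicates — and the two maximality predicates — coincide.  No new definitions, no facts.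
-/

namespace Literature.AlgebraicGeometry.ModuliOfAbelianVarieties.Lan2013.Sec11PreliminariesAlgebraBridge

open Literature.AlgebraicGeometry.ModuliOfAbelianVarieties.Lan2013

universe u

/-- A `ℤ`-subalgebra is recovered from its underlying subring. [folklore] -/
private theorem subalgebraOfSubring_toSubring (B : Type u) [Ring B] (O' : Subalgebra ℤ B) :
    subalgebraOfSubring O'.toSubring = O' :=
  Subalgebra.ext fun _ => Iff.rfl

/-- **Def. 1.1.1.3 for `R = ℤ`, two typings agree**: the subring `O ⊆ B` is a `ℤ`-order in the sense of `IsZOrder` iff the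
`ℤ`-subalgebra with the same carrier is a `ℤ`-order of the `ℚ`-algebra `B` in the sense of `IsOrder ℤ ℚ`.
[cite: Lan2013PELCompactifications, Def. 1.1.1.3 (p. 2; 2010 rev. p. 2)] -/
theorem isOrder_int_iff_isZOrder (B : Type u) [Ring B] [Algebra ℚ B] (O : Subring B) :
    Sec11PreliminariesAlgebra.IsOrder ℤ ℚ B (subalgebraOfSubring O) ↔ Sec142to144IsogenyClasses.IsZOrder B O := by
  have h : Subalgebra.toSubmodule (subalgebraOfSubring O) = AddSubgroup.toIntSubmodule O.toAddSubgroup := by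
    ext x; rfl
  unfold Sec11PreliminariesAlgebra.IsOrder Sec142to144IsogenyClasses.IsZOrder
  constructor
  · intro hL
    exact ⟨h ▸ hL.fg, hL.span_eq_top⟩
  · rintro ⟨hfg, hsp⟩
    exact ⟨h ▸ hfg, hsp⟩

/-- **Def. 1.1.1.4 for `R = ℤ`, two typings agree**: maximal `ℤ`-orders in the sense of `IsMaximalZOrder` (subrings) and of
`IsMaximalOrder ℤ ℚ` (`ℤ`-subalgebras) correspond under `subalgebraOfSubring`.
[cite: Lan2013PELCompactifications, Def. 1.1.1.4 (p. 2; 2010 rev. p. 2)] -/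
theorem isMaximalOrder_int_iff_isMaximalZOrder (B : Type u) [Ring B] [Algebra ℚ B] (O : Subring B) :
    Sec11PreliminariesAlgebra.IsMaximalOrder ℤ ℚ B (subalgebraOfSubring O) ↔
      Sec142to144IsogenyClasses.IsMaximalZOrder B O := by
  unfold Sec11PreliminariesAlgebra.IsMaximalOrder Sec142to144IsogenyClasses.IsMaximalZOrder
  rw [isOrder_int_iff_isZOrder]
  refine and_congr_right fun _ => ⟨fun h O' hO' hle => ?_, fun h O' hO' hle => ?_⟩
  · have key := h (subalgebraOfSubring O') ((isOrder_int_iff_isZOrder B O').mpr hO') (fun x hx => hle hx)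
    exact Subring.ext fun x => by
      have hx := congrArg (fun S : Subalgebra ℤ B => x ∈ S) key
      simpa using hx
  · have hO'' : Sec142to144IsogenyClasses.IsZOrder B O'.toSubring :=
      (isOrder_int_iff_isZOrder B O'.toSubring).mp (by rw [subalgebraOfSubring_toSubring]; exact hO')
    have key := h O'.toSubring hO'' (fun x hx => hle hx)
    rw [← subalgebraOfSubring_toSubring B O', key]

end Literature.AlgebraicGeometry.ModuliOfAbelianVarieties.Lan2013.Sec11PreliminariesAlgebraBridge
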